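import Summits.BirchSwinnertonDyer.BirchSwinnertonDyer.Theorems.GenusKolyvaginAtTwoOffCutResidualAtTwoRVisibleDeepSocleHeegnerLine
import Summits.BirchSwinnertonDyer.BirchSwinnertonDyer.Theorems.GenusKolyvaginAtTwoOffCutResidualAtTwoRVisibleDeepSocleLevelDescent
import HarnessLib

/-!
# Route `GenusKolyvaginAtTwo`, residual `OffCutResidualAtTwoR` (stmt-BirchSwinnertonDyer-31767), LINE 28 «visible_deep_socle»:
# STUB N2 `stub_deepFrameSocle` PROVED — statement VERBATIM ((HL) ∧ (SOC) ∧ (LTV))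

LEAD seat `bsd-line-gk2-p1` g25 (cell `bsd-f1-sign2`), `--supports stmt-BirchSwinnertonDyer-31767 --as helper`.  THEOREMS ONLY (no definition, no named fact,
no `sorry`); the pen may plug `stub_deepFrameSocle := SocleSelection.deepFrameSocle` by name.  ASSEMBLY of: (HL) `heegnerLift_of_doorTrivial_nonPhantom_rat`
(`…VisibleDeepSocleHeegnerLine`: the Heegner line's socle is the lift of the `ℓ₀`-trivial Selmer class; a phantom multiple is `2`-torsion hence the socle)
+ `phantom_level_descent` (`…VisibleDeepSocleLevelDescent`, over gk2-p4 g10's level-`4` theorem) + the frame's OWN `ℓ₀`-VIS hypothesis; (SOC)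
`sharedSocle_of_doorTrivialSocle` and (LTV) `exists_doorTrivial_ne_zero_of_deepPrimeFrame` (`…VisibleDeepSocleSOC`).  The twin budget `ord₂ c(Wd) ≤ 1` is carried
unused; PRINT used: `MultPublishedInputsAtTwo` (ranks `0 + 1`).
**BSD is NOT proved by this; `OffCutResidualAtTwoR` (31767), K4Neg (31526), crux 23491 stay OPEN; LINE 28 still needs N1 (the ξ-VISIBLE deep SUPPLY — analytic
rank one of `E^{(-ℓ₀)}` on a Čebotarev class — beyond print) and N6′ (the climb).**

References: [GrossLMS1991] §4 (4.4), §5 (5.1); [McCallumLMS1991] §4 (6), Lemma 4.6, §5 Lemma 5.1; [MazurRubin2010] Lemma 2.2, Prop. 3.3; [Kramer1981] Thm. 1;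
[LawsonWuthrich2016] §3, §7.1.
-/

set_option autoImplicit false
-- the Theorems namespace of this sub repeats the summit name by design (D-0017 nested layout)
set_option linter.dupNamespace false

noncomputable section

open scoped Classical

namespace Summit.BirchSwinnertonDyer.BirchSwinnertonDyer.Theorems.GenusExact.PlusDescent.SocleSelection

open WeierstrassCurve NumberField IsDedekindDomain Field
open Literature.NumberTheory.EllipticCurves Literature.NumberTheory.GaloisRepresentations
open Literature.NumberTheory.EllipticCurves.ModularForms Literature.NumberTheory.EllipticCurves.KolyvaginCocycle
open Summit.BirchSwinnertonDyer.BirchSwinnertonDyer.Theses.GenusKolyvaginAtTwo (MultPublishedInputsAtTwo)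

/-- **LINE 28 STUB N2 `stub_deepFrameSocle` — PROVED, statement VERBATIM ((HL) ∧ (SOC) ∧ (LTV)).**  (HL): `heegnerLift_of_doorTrivial_nonPhantom_rat` + the frame's
own `ℓ₀`-VIS hypothesis via `phantom_level_descent`; (SOC): `sharedSocle_of_doorTrivialSocle`; (LTV): `exists_doorTrivial_ne_zero_of_deepPrimeFrame`.  The twin budget
`ord₂ c(Wd) ≤ 1` is carried unused.  **BSD is NOT proved by this; `OffCutResidualAtTwoR`, K4Neg, crux 23491 stay OPEN; LINE 28 still needs N1 (the ξ-visible deep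
SUPPLY) and N6′ (the climb).** [cite: GrossLMS1991, §4 (4.4), §5 (5.1)] [cite: McCallumLMS1991, §4 Lemma 4.6] [cite: MazurRubin2010, Prop. 3.3] [cite: LawsonWuthrich2016, §3, §7.1] -/
theorem deepFrameSocle :
    ∀ (W : WeierstrassCurve ℚ) [W.IsElliptic] [W.IsGloballyMinimal] [NeZero (W.conductorNorm ℤ)],
      W.analyticRank = 0 → (∀ n : ℕ, 0 < n → W.HasSurjectiveModNGaloisRep ((2 : ℤ) ^ n)) → Odd W.tamagawaProduct → W.Δ < 0 →
      ∀ (K : Type) [Field K] [NumberField K], IsImaginaryQuadratic K → Odd (NumberField.discr K) → NumberField.discr K ≠ -3 →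
        SatisfiesHeegnerHypothesis (W.conductorNorm ℤ) K →
        ¬ IsSquare ((NumberField.discr K : ℚ) * -|W.Δ|) → ¬ IsSquare ((NumberField.discr K : ℚ) * (-(2 * |W.Δ|))) →
      ∀ (ℓ₀ : ℕ) (v : HeightOneSpectrum (𝓞 ℚ)), ℓ₀.Prime → NumberField.discr K = -(ℓ₀ : ℤ) →
        ((Ideal.span {(2 : ℤ)}).primesOver (𝓞 K)).ncard = 2 → ((ℓ₀ : ℕ) : 𝓞 ℚ) ∈ v.asIdeal →
        (∀ c : galH1Torsion W 2, c ∈ W.selmerGroup 2 → c ∈ W.torsionLocalKer (v.adicCompletion ℚ) 2 →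
            (∀ (h₁₂ : (2 : ℤ) ∣ ((2 ^ 2 : ℕ) : ℤ)), ∀ ρ ∈ torsionFixing W ((2 ^ 2 : ℕ) : ℤ),
              h1Eval W ((2 ^ 2 : ℕ) : ℤ) (torsionH1OfDvd W h₁₂ c) ρ = 0) → c = 0) →
      ∀ (Dt : ModularParametrizationData W (W.conductorNorm ℤ)),
        (∀ z ∈ Dt.L.lattice, ∃ w ∈ periodLattice Dt.f, z = (Dt.c : ℂ) * w) → Odd Dt.c →
      ∀ (β : ℤ) (ι : K →+* ℂ) (d₁ : KolyvaginHeegnerData Dt β ι 1), ¬ IsOfFinAddOrder d₁.derivedPoint →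
      ∀ (M₀ : ℕ), (∃ Q : (W.baseChange (ringClassField K ι 1)).toAffine.Point, ((2 ^ M₀ : ℕ) : ℤ) • Q = d₁.derivedPoint) →
        (¬ ∃ Q : (W.baseChange (ringClassField K ι 1)).toAffine.Point, ((2 ^ (M₀ + 1) : ℕ) : ℤ) • Q = d₁.derivedPoint) →
      ∀ (Wd : WeierstrassCurve ℚ) [Wd.IsElliptic] [Wd.IsGloballyMinimal],
        (∃ C : WeierstrassCurve.VariableChange ℚ, C • W.quadraticTwist (NumberField.discr K : ℚ) = Wd) →
        Wd.analyticRank = 1 → Nat.card (Wd.selmerGroup 2) = 2 → padicValNat 2 Wd.tamagawaProduct ≤ 1 →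
      Nat.card (W.selmerGroup 2) = 4 → MultPublishedInputsAtTwo →
      -- (HL)
      (∀ (M : ℕ) (hdvd : ((2 ^ M : ℕ) : ℤ) ∣ ((2 ^ (M + 1) : ℕ) : ℤ)) (c : ℤ),
          (∀ ρ ∈ torsionFixing (W.baseChange K) ((2 ^ (M + 1) : ℕ) : ℤ), h1Eval (W.baseChange K) ((2 ^ (M + 1) : ℕ) : ℤ)
              (c • torsionH1OfDvd (W.baseChange K) hdvd (d₁.kolyvaginClass Nat.prime_two M)) ρ = 0) →
          c • torsionH1OfDvd (W.baseChange K) hdvd (d₁.kolyvaginClass Nat.prime_two M) = 0) ∧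
      -- (SOC) for Good⁻ classes
      (∀ (M : ℕ), M₀ + 1 ≤ M → ∀ (s₀ : galH1Torsion W ((2 ^ M : ℕ) : ℤ)), s₀ ∈ selmerGroup W ((2 ^ M : ℕ) : ℤ) →
          (∃ c : galH1Torsion W 2, c ≠ 0 ∧ c ∈ W.torsionLocalKer (v.adicCompletion ℚ) 2 ∧
            ∀ hdvd₁ : (2 : ℤ) ∣ ((2 ^ M : ℕ) : ℤ), torsionH1OfDvd W hdvd₁ c ∈ AddSubgroup.zmultiples s₀) →
          ∀ (hdvd : ((2 ^ M : ℕ) : ℤ) ∣ ((2 ^ (M + 1) : ℕ) : ℤ)), ∃ i j : ℕ,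
            ((2 ^ i : ℕ) : ℤ) • torsionH1OfDvd (W.baseChange K) hdvd (resTorsion W K ((2 ^ M : ℕ) : ℤ) s₀) =
              ((2 ^ j : ℕ) : ℤ) • torsionH1OfDvd (W.baseChange K) hdvd (d₁.kolyvaginClass Nat.prime_two M) ∧
            ((2 ^ j : ℕ) : ℤ) • torsionH1OfDvd (W.baseChange K) hdvd (d₁.kolyvaginClass Nat.prime_two M) ≠ 0 ∧
            (2 : ℤ) • (((2 ^ j : ℕ) : ℤ) • torsionH1OfDvd (W.baseChange K) hdvd (d₁.kolyvaginClass Nat.prime_two M)) = 0) ∧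
      -- (LTV)
      (∃ u ∈ W.selmerGroup 2, u ≠ 0 ∧ u ∈ W.torsionLocalKer (v.adicCompletion ℚ) 2) := by
  intro W _ _ _ hr0 hρ hTam hneg K _ _ hIQ hodd h3 hHe hsq1 hsq2 ℓ₀ v hℓ₀ hdK h2K hv hVIS Dt hopt hc β ι d₁ hy M₀ hdiv hndiv Wd _ _ hWd hrd hSel
    hbudget h4 hGZK
  refine ⟨?_, sharedSocle_of_doorTrivialSocle W hr0 hρ hTam hneg K hIQ hodd h3 hHe hsq1 hsq2 ℓ₀ v hℓ₀ hdK h2K hv hVIS Dt hopt hc β ι d₁ hy M₀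
      hdiv hndiv Wd hWd hrd hSel hbudget h4 hGZK,
    exists_doorTrivial_ne_zero_of_deepPrimeFrame W hr0 hρ hTam hneg K hIQ hodd h3 hHe hsq1 hsq2 ℓ₀ v hℓ₀ hdK h2K hv hVIS Dt hopt hc β ι d₁ hy M₀
      hdiv hndiv Wd hWd hrd hSel hbudget h4 hGZK⟩
  refine heegnerLift_of_doorTrivial_nonPhantom_rat W hr0 hρ hTam hneg K hIQ hodd h3 hHe hsq1 hsq2 ℓ₀ v hℓ₀ hdK h2K hv hVIS Dt hopt hc β ι d₁ hy M₀
    hdiv hndiv Wd hWd hrd hSel hbudget h4 hGZK fun M hM h1 u huS hu0 huv hph ↦ hu0 ?_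
  exact hVIS u huS huv fun h₁₂ ↦ phantom_level_descent W hρ (by omega : 2 ≤ M + 1) u h1 h₁₂ hph

end Summit.BirchSwinnertonDyer.BirchSwinnertonDyer.Theorems.GenusExact.PlusDescent.SocleSelection

end
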